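import Literature.NumberTheory.EllipticCurves.ZpExtensionEisensteinTwistDualityForm
import Literature.NumberTheory.EllipticCurves.ConjugatePairingDuality
import Literature.NumberTheory.EllipticCurves.ZpExtensionScalarTwistMaps
import HarnessLib

/-!
# The sign of complex conjugation on the duality forms: `ẽ(θa, θb) = −ẽ(a, b)` and
# `e((1 ⊗ θ)s, (1 ⊗ θ)t) = −e(s, t)` on the Eisenstein levels (input of H.5(c); proofs file)

Topic `NumberTheory/EllipticCurves` (sequel to `ConjugatePairingDuality`, `ZpExtensionEisensteinTwistDualityForm`).
THEOREMS ONLY (no definition, no named fact, no instance, no `sorry`).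

Howard 2004, H.5(c): «If H.4 is assumed to hold then the residual pairing `T̄ × T̄ → (R/𝔪)(1)` satisfies
`(s^τ, t^τ) = (s,t)^τ`» — `τ` acting on `R(1)` by `χ(τ) = −1`. The cell's typed `Howard2004.H5c D π̄ A` asks this
for the duality datum `D` modulo `𝔪` on lifts; the MODULE-LEVEL identity behind it is supplied here:

* §1 (`E`-level) `conjPairing_theta_theta`: for `ẽ = conjPairing e θ log` (`(a,b) ↦ log e(a, θb)`) with `θ` an
  involution and `e(θa, θb) = −e(a,b)`: **`ẽ(θa, θb) = −ẽ(a, b)`**.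
* §2 (generic `𝒪`, `ι`, `ẽ`) `scalarForm_coeffExtensionLinear`: if `ẽ(f₁ a, f₂ b) = u · ẽ(a, b)` then
  `e((1⊗f₁) x, (1⊗f₂) y) = ι(u) · e(x, y)` for `e = scalarForm ι ẽ`; `…_of_neg` (`u = −1`).
* §3 (Eisenstein levels) **`eisensteinDualityForm_conj_conj`**: `e(Θ s, Θ t) = −e(s, t)` for
  `Θ = 1 ⊗ θ = coeffExtensionLinear A_{m,k} θ` whenever `ẽ(θa, θb) = −ẽ(a,b)` — with x9-p1-w2's residual presentation
  (`ker π̄ = 𝔪 · (M ⊗ A_{m,k})`) this gives `H5c` for `eisensteinDualityDatum` (reduction mod `𝔪` of a bilinear identity).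

References: [Howard2004HeegnerKolyvagin] B. Howard, Compositio Math. 140 (2004), §1.3, H.5(c) (arXiv p. 7 L98 – p. 8 L1),
Rem. 1.3.2. BSD is not proved by any of this.
-/

noncomputable section

open scoped TensorProduct

universe u v w₁ w₂

namespace Literature.NumberTheory.EllipticCurves

open Literature.NumberTheory.GaloisRepresentations

/-! ## §1 `E`-level: `ẽ(θa, θb) = −ẽ(a, b)` -/

section ELevel

variable {K : Type u} [Field K] {M : Type u} [AddCommGroup M] {n : ℕ}
  (e : M →+ M →+ DiscreteGaloisModule.MuCarrier K n) (θ : M →+ M) (log : DiscreteGaloisModule.MuCarrier K n →+ ZMod n)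

/-- **`ẽ(θa, θb) = −ẽ(a, b)`** for `ẽ(a, b) = log e(a, θb)`, `θ` an involution with `e(θa, θb) = −e(a, b)` — `τ` acts on
the values of the pairing by `χ(τ) = −1`. [cite: Howard2004HeegnerKolyvagin, H.5(c) (arXiv p. 7 L98 – p. 8 L1) and Rem. 1.3.2] -/
theorem conjPairing_theta_theta (hθθ : ∀ a : M, θ (θ a) = a) (hθe : ∀ a b : M, e (θ a) (θ b) = -e a b) (a b : M) :
    conjPairing e θ log (θ a) (θ b) = -conjPairing e θ log a b := by
  rw [conjPairing_apply, conjPairing_apply, hθθ, show e (θ a) b = e (θ a) (θ (θ b)) by rw [hθθ], hθe, map_neg]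

end ELevel

/-! ## §2 Generic: the scalar form under `1 ⊗ f` -/

section Generic

variable {𝒪 : Type v} [CommRing 𝒪] {n : ℕ} (ι : ZMod n →+* 𝒪)
  {M₁ : Type w₁} {M₂ : Type w₂} [AddCommGroup M₁] [AddCommGroup M₂] (eb : M₁ →+ M₂ →+ ZMod n)

/-- **`e((1⊗f₁) x, (1⊗f₂) y) = ι(u) · e(x, y)`** for `e = scalarForm ι ẽ` whenever `ẽ(f₁ a, f₂ b) = u · ẽ(a, b)`
(`1 ⊗ fᵢ` = tree `DiscreteGaloisModule.coeffExtensionLinear`). [cite: Howard2004HeegnerKolyvagin, H.5(c) and Lemma 2.1.1] -/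
theorem scalarForm_coeffExtensionLinear (f₁ : M₁ →ₗ[ℤ] M₁) (f₂ : M₂ →ₗ[ℤ] M₂) (u : ZMod n)
    (hf : ∀ (a : M₁) (b : M₂), eb (f₁ a) (f₂ b) = u * eb a b) (x : CoeffExtension ℤ 𝒪 M₁) (y : CoeffExtension ℤ 𝒪 M₂) :
    scalarForm ι eb (DiscreteGaloisModule.coeffExtensionLinear 𝒪 f₁ x) (DiscreteGaloisModule.coeffExtensionLinear 𝒪 f₂ y) =
      ι u * scalarForm ι eb x y := by
  rw [scalarForm_apply_apply, scalarForm_apply_apply]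
  induction x using CoeffExtension.induction_on with
  | zero => simp only [map_zero, AddMonoidHom.zero_apply, mul_zero]
  | tmul c₁ a₁ =>
    induction y using CoeffExtension.induction_on with
    | zero => simp only [map_zero, mul_zero]
    | tmul c₂ a₂ =>
      rw [DiscreteGaloisModule.coeffExtensionLinear_tmul, DiscreteGaloisModule.coeffExtensionLinear_tmul,
        scalarFormHom_tmul_tmul, scalarFormHom_tmul_tmul, hf, map_mul]
      ring
    | add y y' hy hy' => rw [map_add, map_add, map_add, hy, hy', mul_add]
  | add x x' hx hx' =>
    rw [map_add, map_add, AddMonoidHom.add_apply, map_add, AddMonoidHom.add_apply, hx, hx', mul_add]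

/-- The case `u = −1`: **`e((1⊗f₁) x, (1⊗f₂) y) = −e(x, y)`**. [cite: Howard2004HeegnerKolyvagin, H.5(c) and Lemma 2.1.1] -/
theorem scalarForm_coeffExtensionLinear_of_neg (f₁ : M₁ →ₗ[ℤ] M₁) (f₂ : M₂ →ₗ[ℤ] M₂)
    (hf : ∀ (a : M₁) (b : M₂), eb (f₁ a) (f₂ b) = -eb a b) (x : CoeffExtension ℤ 𝒪 M₁) (y : CoeffExtension ℤ 𝒪 M₂) :
    scalarForm ι eb (DiscreteGaloisModule.coeffExtensionLinear 𝒪 f₁ x) (DiscreteGaloisModule.coeffExtensionLinear 𝒪 f₂ y) =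
      -scalarForm ι eb x y := by
  rw [scalarForm_coeffExtensionLinear ι eb f₁ f₂ (-1) (fun a b => by rw [hf, neg_one_mul]) x y, map_neg, map_one,
    neg_one_mul]

end Generic

/-! ## §3 The Eisenstein levels: `e(Θ s, Θ t) = −e(s, t)`, `Θ = 1 ⊗ θ` -/

namespace ZpExtension

open IwasawaAlgebra

variable {p : ℕ} [hp : Fact p.Prime] {m : ℕ} (hm : 1 ≤ m) (k : ℕ) {M : Type} [AddCommGroup M]
  (eb : M →+ M →+ ZMod (p ^ k)) (θ : M →+ M)

/-- **`e(Θ s, Θ t) = −e(s, t)` on `M ⊗ A_{m,k}`** for `e = eisensteinDualityForm hm k ẽ` and `Θ = 1 ⊗ θ`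
(`DiscreteGaloisModule.coeffExtensionLinear A_{m,k} θ`), whenever `ẽ(θa, θb) = −ẽ(a, b)` (e.g. `ẽ = conjPairing e θ log`,
`conjPairing_theta_theta`) — the module-level identity whose reduction modulo `𝔪` is H.5(c) for the Eisenstein levels.
[cite: Howard2004HeegnerKolyvagin, H.5(c) (arXiv p. 7 L98 – p. 8 L1)] -/
theorem eisensteinDualityForm_conj_conj (hθ : ∀ a b : M, eb (θ a) (θ b) = -eb a b)
    (s t : EisensteinCoeff.Twisted p m k M) :
    eisensteinDualityForm hm k eb
        (DiscreteGaloisModule.coeffExtensionLinear (EisensteinCoeff p m k) θ.toIntLinearMap s)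
        (DiscreteGaloisModule.coeffExtensionLinear (EisensteinCoeff p m k) θ.toIntLinearMap t) =
      -eisensteinDualityForm hm k eb s t :=
  scalarForm_coeffExtensionLinear_of_neg (EisensteinCoeff.ofZMod p hm k) eb θ.toIntLinearMap θ.toIntLinearMap
    (fun a b => hθ a b) s t

/-- Specialisation to `ẽ = conjPairing e θ log` (the Weil-pairing-with-`τ` form of `ConjugatePairingDuality`): the sign
hypothesis is `conjPairing_theta_theta`. [cite: Howard2004HeegnerKolyvagin, H.5(c) and Rem. 1.3.2] -/
theorem eisensteinDualityForm_conjPairing_conj_conj {K : Type} [Field K]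
    (e : M →+ M →+ DiscreteGaloisModule.MuCarrier K (p ^ k)) (log : DiscreteGaloisModule.MuCarrier K (p ^ k) →+ ZMod (p ^ k))
    (hθθ : ∀ a : M, θ (θ a) = a) (hθe : ∀ a b : M, e (θ a) (θ b) = -e a b) (s t : EisensteinCoeff.Twisted p m k M) :
    eisensteinDualityForm hm k (conjPairing e θ log)
        (DiscreteGaloisModule.coeffExtensionLinear (EisensteinCoeff p m k) θ.toIntLinearMap s)
        (DiscreteGaloisModule.coeffExtensionLinear (EisensteinCoeff p m k) θ.toIntLinearMap t) =
      -eisensteinDualityForm hm k (conjPairing e θ log) s t :=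
  eisensteinDualityForm_conj_conj hm k (conjPairing e θ log) θ (conjPairing_theta_theta e θ log hθθ hθe) s t

end ZpExtension

end Literature.NumberTheory.EllipticCurves
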